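import Summits.QuantumFields.YangMills.Theorems.F4SubCurvatureDoorShellSeparationWindowSymmetry
import Summits.QuantumFields.YangMills.Theorems.F4SubCurvatureDoorRationalToGeneralFibreReduction
import Summits.QuantumFields.YangMills.Theorems.F4SubCurvatureDoorRationalToGeneralMirrorPatching
import Mathlib
import HarnessLib

/-!
# LINE g21-A/g21-B (⟨stmt-QuantumFields-23125⟩) — S2 helper: the window kernel `K_S` of a shell-separated measure is a budget-free class kernel

Helper toward the registered stub S2 `stub_shellSeparation`.  For a class kernel `K` with Laplace–Fourier measure `μ` and no deep space-like mass,
and a measurable mass window `S`, the window measure `ν = μ|{massSq ∈ S}` is LF-symmetric (✓`symmetricLF_window`); its MIRROR PATCH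
`K_S := patch ν` (the construction of the landed rung R-B4e ✓`MirrorPatching`: `lfEval ν` read after swapping the first non-vanishing coordinate into
the time slot — only LF-symmetry is used) is a BUDGET-FREE CLASS KERNEL (`InClass₀`, the verbatim copy of the tree ✓p725139) with Laplace–Fourier
measure `ν` (`window_classKernel`): continuous off the origin (dominated convergence), bounded outside the unit ball (24-cell covering
✓`shortRootCovering_holds` + ✓`axisDomination_holds` + monotonicity of the axis function), invariant under signed permutations (they preserve `D₄`)
and under all `D₄`-isometries (✓`patch_isometry`), and reflection positive (`Σ cᵢcⱼ K_S(θxᵢ − xⱼ) = ∫ |Σ cᵢ e^{−tᵢE + i q⃗·z⃗ᵢ}|² dν ≥ 0`).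

Mathlib + tree only; no `sorry`; no new definitions.  HONEST LABEL: helper for a registered stub of an OPEN line; S1, S2, ⟨23125⟩, ⟨23035⟩, R2d
and the Yang–Mills mass gap remain OPEN; no summit is proved by a line.
-/

noncomputable section

open MeasureTheory Set Filter Topology
open scoped BigOperators

namespace Summit.QuantumFields.YangMills.Theorems.F4SubCurvatureDoorShellSeparationProof

open Literature.MathematicalPhysics.QuantumLattice (timeReflection timeReflection_apply siteToE siteToE_apply)
open Summit.QuantumFields.YangMills.Cruxes.OSLegsAtWeakCouplingC.Sketch (IsSignedPerm)
open Summit.QuantumFields.YangMills.Theorems.F4SubCurvatureDoorLaplaceFourierRegistered (E4 E3 InClass timeSpace IsLF)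
open Summit.QuantumFields.YangMills.Theorems.F4SubCurvatureDoorFibreDichotomyAxis (spacePart lfEval IsD4Isometry SymmetricLF
  axisDomination_holds shortRootCovering_holds lfEval_timeSpace_zero timeSpace_zero spacePart_timeSpace)
open Summit.QuantumFields.YangMills.Theorems.F4SubCurvatureDoorShellLFAnalytic (massSq spacePart_apply lfEval_timeSpace)
open Summit.QuantumFields.YangMills.Theorems.F4SubCurvatureDoorSmearedSlices (ae_nonneg_of_measure_Iio)
open Summit.QuantumFields.YangMills.Theorems.F4SubCurvatureDoorMirrorPatchingRegistered (patch swapIso timeIdx swapIso_apply_zero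
  apply_timeIdx_ne_zero patch_of_ne patch_isometry patch_eventuallyEq)
open Summit.QuantumFields.YangMills.Theorems.F4SubCurvatureDoorFibreReductionRegistered (InClass₀)

variable {ν : Measure (ℝ × E3)}

/-! ## Continuity and bounds of `lfEval` for a Laplace-integrable measure carried by `E ≥ 0` -/

/-- **Continuity of `lfEval ν` off the mirror** (dominated convergence; `E ≥ 0` a.e. and Laplace integrability suffice). -/
theorem continuousAt_lfEval (h0 : ν (Set.Iio (0 : ℝ) ×ˢ (Set.univ : Set E3)) = 0)
    (hint : ∀ t : ℝ, 0 < t → Integrable (fun p : ℝ × E3 => Real.exp (-(t * p.1))) ν) {u : E4} (hu : u 0 ≠ 0) :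
    ContinuousAt (lfEval ν) u := by
  have hs : 0 < |u 0| / 2 := by positivity
  have hE := ae_nonneg_of_measure_Iio ν h0
  -- near `u` the time coordinate stays above `|u 0|/2` in absolute value
  have hnear : ∀ᶠ y in 𝓝 u, |u 0| / 2 < |y 0| := by
    have hc : Continuous fun y : E4 => |y 0| := by fun_prop
    exact hc.continuousAt.eventually (lt_mem_nhds (by linarith [abs_pos.2 hu]))
  refine continuousAt_of_dominated (F := fun (y : E4) (p : ℝ × E3) => Real.exp (-(|y 0| * p.1)) * Real.cos (inner ℝ p.2 (spacePart y)))
    (bound := fun p => Real.exp (-(|u 0| / 2 * p.1))) ?_ ?_ (hint _ hs) ?_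
  · exact Eventually.of_forall fun y => (by fun_prop : Continuous fun p : ℝ × E3 =>
      Real.exp (-(|y 0| * p.1)) * Real.cos (inner ℝ p.2 (spacePart y))).aestronglyMeasurable
  · filter_upwards [hnear] with y hy
    filter_upwards [hE] with p hp
    rw [Real.norm_eq_abs, abs_mul, abs_of_pos (Real.exp_pos _)]
    calc Real.exp (-(|y 0| * p.1)) * |Real.cos _| ≤ Real.exp (-(|y 0| * p.1)) * 1 :=
          mul_le_mul_of_nonneg_left (Real.abs_cos_le_one _) (Real.exp_pos _).le
      _ ≤ Real.exp (-(|u 0| / 2 * p.1)) := by rw [mul_one]; exact Real.exp_le_exp.2 (by nlinarith)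
  · refine Eventually.of_forall fun p => ?_
    have h1 : Continuous fun y : E4 => |y 0| := by fun_prop
    have h2 : Continuous (spacePart : E4 → E3) :=
      Summit.QuantumFields.YangMills.Theorems.F4SubCurvatureDoorShellLFAnalytic.continuous_spacePart
    exact ((Real.continuous_exp.comp ((h1.mul continuous_const).neg)).mul
      (Real.continuous_cos.comp (continuous_const.inner h2))).continuousAt

/-- **The axis function is non-increasing** (`E ≥ 0` a.e. suffices). -/
theorem lfEval_axis_antitone' (h0 : ν (Set.Iio (0 : ℝ) ×ˢ (Set.univ : Set E3)) = 0)
    (hint : ∀ t : ℝ, 0 < t → Integrable (fun p : ℝ × E3 => Real.exp (-(t * p.1))) ν) {t t' : ℝ} (ht : 0 < t) (htt' : t ≤ t') :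
    lfEval ν (timeSpace t' 0) ≤ lfEval ν (timeSpace t 0) := by
  have ht' : 0 < t' := lt_of_lt_of_le ht htt'
  rw [lfEval_timeSpace_zero, lfEval_timeSpace_zero, abs_of_pos ht, abs_of_pos ht']
  refine integral_mono_ae (hint t' ht') (hint t ht) ?_
  filter_upwards [ae_nonneg_of_measure_Iio ν h0] with p hp
  exact Real.exp_le_exp.2 (by nlinarith)

/-! ## Signed permutations preserve the checkerboard lattice -/

/-- **A signed coordinate permutation is a `D₄`-isometry.** -/
theorem isD4Isometry_of_isSignedPerm {R : E4 ≃ₗᵢ[ℝ] E4} (hR : IsSignedPerm R) : IsD4Isometry R := by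
  classical
  -- integer matrix `c i j ∈ {0, ±1}` with `R e_i = Σ_j c i j • e_j`
  choose σ hσ using hR
  have hcoord : ∀ i j, ∃ n : ℤ, (R (EuclideanSpace.single i (1 : ℝ))) j = n := by
    intro i j
    rcases hσ i with h | h
    · rw [h]
      by_cases hj : j = σ i
      · exact ⟨1, by subst hj; simp⟩
      · exact ⟨0, by simp [hj]⟩
    · rw [h]
      by_cases hj : j = σ i
      · exact ⟨-1, by subst hj; simp⟩
      · exact ⟨0, by simp [hj]⟩
  choose c hc using hcoord
  -- the parity of a column sum equals one: `Σ_j c i j = ±1`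
  have hcol : ∀ i, Even (∑ j, c i j - 1) := by
    intro i
    have hval : ∀ j, c i j = if j = σ i then (if R (EuclideanSpace.single i 1) = EuclideanSpace.single (σ i) 1 then 1 else -1) else 0 := by
      intro j
      have h := hc i j
      rcases hσ i with h' | h'
      · rw [h'] at h
        rw [if_pos h']
        by_cases hj : j = σ i
        · subst hj; simp at h; rw [if_pos rfl]; exact_mod_cast h.symm
        · simp [hj] at h; rw [if_neg hj]; exact_mod_cast h.symm
      · rw [h'] at h
        have hne : R (EuclideanSpace.single i 1) ≠ EuclideanSpace.single (σ i) (1 : ℝ) := by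
          rw [h']
          intro heq
          have := congrArg (fun v : E4 => v (σ i)) heq
          simp at this
          norm_num at this
        rw [if_neg hne]
        by_cases hj : j = σ i
        · subst hj; simp at h; rw [if_pos rfl]; exact_mod_cast h.symm
        · simp [hj] at h; rw [if_neg hj]; exact_mod_cast h.symm
    simp_rw [hval]
    rw [Finset.sum_ite_eq' Finset.univ (σ i)]
    simp only [Finset.mem_univ, if_true]
    split_ifs
    · exact ⟨0, by ring⟩
    · exact ⟨-1, by ring⟩
  intro z hz
  refine ⟨fun j => ∑ i, z i * c i j, ?_, ?_⟩
  · -- parity: `Σ_j Σ_i z_i c_ij = Σ_i z_i (Σ_j c_ij) ≡ Σ_i z_i (mod 2)`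
    have hswap : ∑ j, ∑ i, z i * c i j = ∑ i, z i * ∑ j, c i j := by
      rw [Finset.sum_comm]
      exact Finset.sum_congr rfl fun i _ => by rw [Finset.mul_sum]
    rw [hswap]
    have hdiff : Even (∑ i, z i * ∑ j, c i j - ∑ i, z i) := by
      rw [← Finset.sum_sub_distrib]
      refine Finset.even_sum _ fun i _ => ?_
      rw [show z i * ∑ j, c i j - z i = z i * (∑ j, c i j - 1) by ring]
      exact (hcol i).mul_left _
    exact (Int.even_sub.1 hdiff).2 hz
  · -- the image of a lattice point
    have hexp : siteToE z = ∑ i : Fin 4, (z i : ℝ) • EuclideanSpace.single i (1 : ℝ) := by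
      ext j
      simp [siteToE_apply, Finset.sum_apply, Pi.single_apply, Finset.sum_ite_eq]
    rw [hexp, map_sum]
    ext j
    rw [siteToE_apply]
    change EuclideanSpace.proj j (∑ i, R ((z i : ℝ) • EuclideanSpace.single i (1 : ℝ))) = ((∑ i, z i * c i j : ℤ) : ℝ)
    rw [map_sum]
    push_cast
    refine Finset.sum_congr rfl fun i _ => ?_
    rw [LinearIsometryEquiv.map_smul, map_smul, smul_eq_mul]
    change (z i : ℝ) * (R (EuclideanSpace.single i 1)) j = _
    rw [hc i j]

/-! ## The window kernel is a budget-free class kernel -/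

/-- **Reflection positivity of `lfEval` on positive times.** -/
theorem lfEval_reflectionPositive (h0 : ν (Set.Iio (0 : ℝ) ×ˢ (Set.univ : Set E3)) = 0)
    (hint : ∀ t : ℝ, 0 < t → Integrable (fun p : ℝ × E3 => Real.exp (-(t * p.1))) ν)
    (m : ℕ) (x : Fin m → E4) (c : Fin m → ℝ) (hx : ∀ i, 0 < x i 0) :
    0 ≤ ∑ i, ∑ j, c i * c j * lfEval ν (timeReflection 4 (x i) - x j) := by
  have hE := ae_nonneg_of_measure_Iio ν h0
  -- the points `θ xᵢ − xⱼ`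
  have hT : ∀ i j, |(timeReflection 4 (x i) - x j) 0| = x i 0 + x j 0 := by
    intro i j
    rw [show (timeReflection 4 (x i) - x j) 0 = timeReflection 4 (x i) 0 - x j 0 from rfl, timeReflection_apply, if_pos rfl]
    rw [abs_of_neg (by linarith [hx i, hx j])]
    ring
  have hS : ∀ i j, spacePart (timeReflection 4 (x i) - x j) = spacePart (x i) - spacePart (x j) := by
    intro i j
    ext k
    rw [spacePart_apply]
    show (timeReflection 4 (x i) - x j) k.succ = (spacePart (x i) - spacePart (x j)) k
    rw [show (timeReflection 4 (x i) - x j) k.succ = timeReflection 4 (x i) k.succ - x j k.succ from rfl,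
      timeReflection_apply, if_neg (Fin.succ_ne_zero k)]
    rw [show (spacePart (x i) - spacePart (x j)) k = spacePart (x i) k - spacePart (x j) k from rfl, spacePart_apply, spacePart_apply]
  -- the integrands
  set a : Fin m → ℝ × E3 → ℝ := fun i p => c i * Real.exp (-(x i 0 * p.1)) * Real.cos (inner ℝ p.2 (spacePart (x i))) with ha
  set b : Fin m → ℝ × E3 → ℝ := fun i p => c i * Real.exp (-(x i 0 * p.1)) * Real.sin (inner ℝ p.2 (spacePart (x i))) with hb
  have hterm : ∀ i j, c i * c j * lfEval ν (timeReflection 4 (x i) - x j) = ∫ p, (a i p * a j p + b i p * b j p) ∂ν := by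
    intro i j
    rw [lfEval, hT, hS, ← integral_const_mul]
    refine integral_congr_ae (ae_of_all _ fun p => ?_)
    simp only [ha, hb, inner_sub_right, Real.cos_sub, add_mul, Real.exp_add, neg_add]
    ring
  have hint_ab : ∀ i j, Integrable (fun p => a i p * a j p + b i p * b j p) ν := by
    intro i j
    have hij : 0 < x i 0 + x j 0 := by linarith [hx i, hx j]
    refine (((hint _ hij).const_mul (|c i| * |c j| * 2))).mono' (by simp only [ha, hb]; fun_prop) ?_
    filter_upwards [hE] with p hp
    simp only [ha, hb, Real.norm_eq_abs]
    have he : Real.exp (-(x i 0 * p.1)) * Real.exp (-(x j 0 * p.1)) = Real.exp (-((x i 0 + x j 0) * p.1)) := by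
      rw [← Real.exp_add]; ring_nf
    have h1 : |Real.cos (inner ℝ p.2 (spacePart (x i))) * Real.cos (inner ℝ p.2 (spacePart (x j))) +
        Real.sin (inner ℝ p.2 (spacePart (x i))) * Real.sin (inner ℝ p.2 (spacePart (x j)))| ≤ 2 := by
      have := Real.abs_cos_le_one (inner ℝ p.2 (spacePart (x i)))
      have := Real.abs_cos_le_one (inner ℝ p.2 (spacePart (x j)))
      have := Real.abs_sin_le_one (inner ℝ p.2 (spacePart (x i)))
      have := Real.abs_sin_le_one (inner ℝ p.2 (spacePart (x j)))
      rw [abs_le] at *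
      constructor <;> nlinarith
    calc |c i * Real.exp (-(x i 0 * p.1)) * Real.cos (inner ℝ p.2 (spacePart (x i))) *
          (c j * Real.exp (-(x j 0 * p.1)) * Real.cos (inner ℝ p.2 (spacePart (x j)))) +
          c i * Real.exp (-(x i 0 * p.1)) * Real.sin (inner ℝ p.2 (spacePart (x i))) *
          (c j * Real.exp (-(x j 0 * p.1)) * Real.sin (inner ℝ p.2 (spacePart (x j))))|
        = |c i| * |c j| * Real.exp (-((x i 0 + x j 0) * p.1)) *
          |Real.cos (inner ℝ p.2 (spacePart (x i))) * Real.cos (inner ℝ p.2 (spacePart (x j))) +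
            Real.sin (inner ℝ p.2 (spacePart (x i))) * Real.sin (inner ℝ p.2 (spacePart (x j)))| := by
          rw [← he]
          rw [show c i * Real.exp (-(x i 0 * p.1)) * Real.cos (inner ℝ p.2 (spacePart (x i))) *
            (c j * Real.exp (-(x j 0 * p.1)) * Real.cos (inner ℝ p.2 (spacePart (x j)))) +
            c i * Real.exp (-(x i 0 * p.1)) * Real.sin (inner ℝ p.2 (spacePart (x i))) *
            (c j * Real.exp (-(x j 0 * p.1)) * Real.sin (inner ℝ p.2 (spacePart (x j)))) =
            (c i * c j * (Real.exp (-(x i 0 * p.1)) * Real.exp (-(x j 0 * p.1)))) *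
            (Real.cos (inner ℝ p.2 (spacePart (x i))) * Real.cos (inner ℝ p.2 (spacePart (x j))) +
              Real.sin (inner ℝ p.2 (spacePart (x i))) * Real.sin (inner ℝ p.2 (spacePart (x j)))) by ring]
          rw [abs_mul, abs_mul, abs_mul, abs_of_pos (mul_pos (Real.exp_pos _) (Real.exp_pos _))]
      _ ≤ |c i| * |c j| * Real.exp (-((x i 0 + x j 0) * p.1)) * 2 := by gcongr
      _ = |c i| * |c j| * 2 * Real.exp (-((x i 0 + x j 0) * p.1)) := by ring
  -- swap sums and integral, complete the square
  have hsum : ∑ i, ∑ j, c i * c j * lfEval ν (timeReflection 4 (x i) - x j) =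
      ∫ p, ((∑ i, a i p) ^ 2 + (∑ i, b i p) ^ 2) ∂ν := by
    simp_rw [hterm]
    have e : (fun p => (∑ i, a i p) ^ 2 + (∑ i, b i p) ^ 2) = fun p => ∑ i, ∑ j, (a i p * a j p + b i p * b j p) := by
      funext p
      rw [sq, sq, Finset.sum_mul_sum, Finset.sum_mul_sum, ← Finset.sum_add_distrib]
      refine Finset.sum_congr rfl fun i _ => ?_
      rw [← Finset.sum_add_distrib]
    rw [e, integral_finsetSum _ (fun i _ => integrable_finsetSum _ fun j _ => hint_ab i j)]
    refine Finset.sum_congr rfl fun i _ => ?_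
    rw [integral_finsetSum _ (fun j _ => hint_ab i j)]
  rw [hsum]
  exact integral_nonneg fun p => by positivity

/-- **The window kernel is a budget-free class kernel with Laplace–Fourier measure the window measure.** -/
theorem window_classKernel (K : E4 → ℝ) (hK : InClass K) {μ : Measure (ℝ × E3)} (hLF : IsLF K μ) {Q₀ : ℝ}
    (hQ : μ {p | massSq p < -Q₀} = 0) {S : Set ℝ} (hS : MeasurableSet S) :
    ∃ KS : E4 → ℝ, InClass₀ KS ∧ IsLF KS (μ.restrict (massSq ⁻¹' S)) := by
  set ν := μ.restrict (massSq ⁻¹' S) with hν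
  have hsym : SymmetricLF ν := symmetricLF_window K hK hLF hQ hS
  obtain ⟨h0μ, hintμ, -⟩ := hLF
  have h0 : ν (Set.Iio (0 : ℝ) ×ˢ (Set.univ : Set E3)) = 0 :=
    le_antisymm ((Measure.restrict_apply_le _ _).trans (le_of_eq h0μ)) zero_le
  have hint : ∀ t : ℝ, 0 < t → Integrable (fun p : ℝ × E3 => Real.exp (-(t * p.1))) ν := fun t ht => (hintμ t ht).restrict
  refine ⟨patch ν, ⟨?_, ?_, ?_, ?_, ?_⟩, ?_⟩
  · -- continuity off the origin
    intro x hx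
    have hx' : x ≠ 0 := hx
    have hev := patch_eventuallyEq (ν := ν) hsym hx'
    have hc : ContinuousAt (fun y : E4 => lfEval ν (swapIso (timeIdx x) y)) x := by
      have h1 : ContinuousAt (lfEval ν) (swapIso (timeIdx x) x) :=
        continuousAt_lfEval h0 hint (by rw [swapIso_apply_zero]; exact apply_timeIdx_ne_zero x hx')
      exact h1.comp (swapIso (timeIdx x)).continuous.continuousAt
    exact (hc.congr hev.symm).continuousWithinAt
  · -- bounded outside the unit ball
    refine ⟨lfEval ν (timeSpace (1 / Real.sqrt 2) 0), fun x hx => ?_⟩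
    obtain ⟨R, hR, hRx⟩ := shortRootCovering_holds x
    have hs2 : 0 < Real.sqrt 2 := Real.sqrt_pos.2 (by norm_num)
    have hpos : 1 / Real.sqrt 2 ≤ |(R x) 0| := (div_le_div_of_nonneg_right hx hs2.le).trans hRx
    have hR0 : (R x) 0 ≠ 0 := fun h => by rw [h, abs_zero] at hpos; exact not_lt.2 hpos (by positivity)
    rw [← patch_isometry hsym hR x, patch_of_ne hR0]
    exact (axisDomination_holds ν (R x) hR0 hint).trans (lfEval_axis_antitone' h0 hint (by positivity) hpos)
  · -- signed permutations
    intro R hR x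
    exact patch_isometry hsym (isD4Isometry_of_isSignedPerm hR) x
  · -- reflection positivity
    intro m x c hx
    have heq : ∀ i j, patch ν (timeReflection 4 (x i) - x j) = lfEval ν (timeReflection 4 (x i) - x j) := by
      intro i j
      refine patch_of_ne ?_
      rw [show (timeReflection 4 (x i) - x j) 0 = timeReflection 4 (x i) 0 - x j 0 from rfl, timeReflection_apply, if_pos rfl]
      linarith [hx i, hx j]
    simp_rw [heq]
    exact lfEval_reflectionPositive h0 hint m x c hx
  · -- `D₄`-invariance
    intro R hR x
    exact patch_isometry hsym hR x
  · -- the Laplace–Fourier representation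
    refine ⟨h0, hint, fun t z ht => ?_⟩
    have hne : (timeSpace t z) 0 ≠ 0 := by rw [timeSpace_zero]; exact ht.ne'
    rw [patch_of_ne hne, lfEval_timeSpace, abs_of_pos ht]

end Summit.QuantumFields.YangMills.Theorems.F4SubCurvatureDoorShellSeparationProof

end
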